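import Literature.NumberTheory.ComplexMultiplication.CMRealConjugationsRealPlaces
import Literature.NumberTheory.NumberFields.RealSignsArtinIsomorphism
import HarnessLib

/-!
# Nekovář (1.3.2.3) with its middle term: `Ker(V_{K/F} : Γ_F^ab → Γ_K^ab) = r_F(F^*/F_+^*) = ⟨c_X⟩` for a CM field `K`,
# `F = K⁺`, and `F^*/F_+^* ⥲ ⟨c_X⟩` on the tree's `⟨c_X⟩ = realConjSubgroup`
# (Nekovář, *Hidden symmetries in the theory of complex multiplication*, §1.3.1, §1.3.2 (1.3.2.3))

Topic `NumberTheory/ComplexMultiplication`; namespace `Literature.NumberTheory.ComplexMultiplication`.  Lane `lit-hodgefound`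
(Track 2, Layer A3 skeleton seat `skel-3`, row A3-G134): the bridge between row A3-G133 (`…/NumberFields/RealSignsArtinIsomorphism`:
`archArtinHom F = a ↦ [(a)_∞, F]` with `ker = F_+^*`, `range = ⟨c_X⟩ = Subgroup.closure (range c_·)`, `F^*/F_+^* ≃* ⟨c_X⟩`) and the
CM-side objects of rows A3-G81/102/116/117/131 (`realConjSubgroup`, `Ker(V_{K/F})`).  Two definitions with bodies (the two
`MulEquiv`s) and THEOREMS; no named fact, no instance, no notation (D-0026, net debt 0).

## The print, verbatim

J. Nekovář, *Hidden symmetries in the theory of complex multiplication*, Progr. Math. 270 (2009) [Nekovar2009HiddenSymmetries]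
(held `paper:doi-10-1007-978-0-8176-4747-6-13`), §1.3.1 (p0010 L16–18): «`r_F` induces an isomorphism `F^*/F_+^* ⥲ ⟨c_X⟩`»;
§1.3.2 (p0010): «(1.3.2.3) `Ker(V_{K/F} : Γ_F^ab → Γ_K^ab) = r_F(Ker(i_{K/F})) = r_F(F^*/F_+^*) = ⟨c_X⟩`.»

Row A3-G116 (`…/NumberFields/VerlagerungCMKernel`) proved `Ker(V_{K/F}) = ⟨c_X⟩`; row A3-G117 (`…/CMRealConjugationsRealPlaces`)
`Ker(V_{K/F}) = realConjSubgroup`; row A3-G133 `r_F(F^*/F_+^*) = ⟨c_X⟩` for every number field.  HERE: the middle equality of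
(1.3.2.3) and the induced isomorphisms `F^*/F_+^* ⥲ Ker(V_{K/F})`, `F^*/F_+^* ⥲ realConjSubgroup`, with `|Ker(V_{K/F})| = 2^{[F:ℚ]}`.
NOT HERE: the term `r_F(Ker(i_{K/F}))` (`i_{K/F} : F̂^*/F_+^* → K̂^*/K^*`; the idèle-class quotients are not the tree's currency).

## Dictionary

`F = K⁺ = maximalRealSubfield K`; `V_{K/F} = verlagerung (maximalRealSubfield K) K`; `r_F` on `F^*/F_+^*` is `archArtinHom F`
(`[(a)_f, F] = [(a)_∞, F]`, row A3-G114); `F_+^* = totallyPositiveUnits F`; `⟨c_X⟩` is `Subgroup.closure (range fun x ↦ [c_x])` (any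
complex conjugations `c_x` at the real places), equal to rows A3-G81/102's `realConjSubgroup (isCMStabilizerPair_realImage K hc) hs
(cmRealAutProj K)` by row A3-G131 `realConjSubgroup_eq_closure_range`.

## Main results

* §1 **`ker_verlagerung_eq_range_archArtinHom`** («`Ker(V_{K/F}) = r_F(F^*/F_+^*)`»), `verlagerung_archArtinHom` (`V_{K/F}(r_F(a)) = 1`),
  `verlagerung_eq_one_iff_exists_archArtinHom_eq`, **`quotientTotallyPositiveUnitsEquivKerVerlagerung : Fˣ ⧸ F_+^* ≃* Ker(V_{K/F})`**
  (+`coe_…_mk`), `natCard_ker_verlagerung` (`= 2^{|X|}`), `natCard_ker_verlagerung_eq_two_pow_finrank` (`= 2^{[F:ℚ]}`).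
* §2 **`realConjSubgroup_eq_range_archArtinHom`** (`⟨c_X⟩` of rows A3-G81/102 `= r_F(F^*/F_+^*)`),
  **`quotientTotallyPositiveUnitsEquivRealConjSubgroup : Fˣ ⧸ F_+^* ≃* realConjSubgroup`** («`r_F` induces an isomorphism
  `F^*/F_+^* ⥲ ⟨c_X⟩`» on the CM-side object) (+`coe_…_mk`), `archArtinHom_mem_realConjSubgroup`.

## References

* [Nekovar2009HiddenSymmetries] J. Nekovář, *Hidden symmetries in the theory of complex multiplication*, Progr. Math. 270,
  Birkhäuser 2009, 399–460, §1.3.1, §1.3.2 (1.3.2.3). [cite: Nekovar2009HiddenSymmetries, §1.3.2 (1.3.2.3)]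
* [MilneCM2006] J. S. Milne, *Complex Multiplication* (2006), Ch. II §9, Lemma 9.6 (row A3-G116's input). [cite: MilneCM2006, Ch. II §9 Lemma 9.6]

## Provenance

Lane `lit-hodgefound`, seat `literature-prover-lit-hodgefound-skel-3-g51-0` (row A3-G134).
-/

noncomputable section

open NumberField Field Literature.NumberTheory.GaloisRepresentations Literature.NumberTheory.NumberFields

namespace Literature.NumberTheory.ComplexMultiplication

/-! ### §1. «`Ker(V_{K/F}) = r_F(F^*/F_+^*)`» and `F^*/F_+^* ⥲ Ker(V_{K/F})` -/

section Kernel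

variable (K : Type) [Field K] [NumberField K] [IsCMField K]

/-- **NEKOVÁŘ (1.3.2.3), middle term: `Ker(V_{K/F} : Γ_F^ab → Γ_K^ab) = r_F(F^*/F_+^*)`** for a CM field `K` with `F = K⁺` — the
kernel of the transfer is the image of `a ↦ [(a)_∞, F]` on `F^×` (row A3-G116 `Ker(V_{K/F}) = ⟨c_X⟩` and row A3-G133
`range_archArtinHom : r_F(F^*) = ⟨c_X⟩`). [cite: Nekovar2009HiddenSymmetries, §1.3.2 (1.3.2.3)] -/
theorem ker_verlagerung_eq_range_archArtinHom :
    (verlagerung (maximalRealSubfield K) K).toMonoidHom.ker = (archArtinHom (maximalRealSubfield K)).range := by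
  have hex : ∀ x : {v : InfinitePlace (maximalRealSubfield K) // v.IsReal},
      ∃ c' : absoluteGaloisGroup (maximalRealSubfield K), IsComplexConjugationAt x.2 c' := fun x => exists_isComplexConjugation _
  choose cF hcF using hex
  rw [ker_verlagerung_eq_closure_range_absGaloisAbProj K cF hcF, range_archArtinHom cF hcF]

/-- `V_{K/F}(r_F(a)) = V_{K/F}([(a)_∞, F]) = 1` for every `a ∈ F^×`. [cite: Nekovar2009HiddenSymmetries, §1.3.2 (1.3.2.3)] -/
theorem verlagerung_archArtinHom (a : (maximalRealSubfield K)ˣ) :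
    verlagerung (maximalRealSubfield K) K (archArtinHom (maximalRealSubfield K) a) = 1 := by
  have h : archArtinHom (maximalRealSubfield K) a ∈ (verlagerung (maximalRealSubfield K) K).toMonoidHom.ker := by
    rw [ker_verlagerung_eq_range_archArtinHom K]
    exact ⟨a, rfl⟩
  exact (MonoidHom.mem_ker.1 h)

/-- (1.3.2.3) elementwise: **`V_{K/F}(h) = 1 ↔ h = [(a)_∞, F]` for some `a ∈ F^×`**. [cite: Nekovar2009HiddenSymmetries, §1.3.2 (1.3.2.3)] -/
theorem verlagerung_eq_one_iff_exists_archArtinHom_eq (h : absoluteGaloisGroupAbelianization (maximalRealSubfield K)) :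
    verlagerung (maximalRealSubfield K) K h = 1 ↔ ∃ a : (maximalRealSubfield K)ˣ, archArtinHom (maximalRealSubfield K) a = h := by
  have h1 : h ∈ (verlagerung (maximalRealSubfield K) K).toMonoidHom.ker ↔ h ∈ (archArtinHom (maximalRealSubfield K)).range := by
    rw [ker_verlagerung_eq_range_archArtinHom K]
  rw [MonoidHom.mem_ker, MonoidHom.mem_range] at h1
  exact h1

/-- **`r_F : F^*/F_+^* ⥲ Ker(V_{K/F})`** (first isomorphism theorem for `archArtinHom F`: `ker = F_+^*` by row A3-G133, `range = Ker(V_{K/F})`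
by (1.3.2.3)).  A DEFINITION (with body). [cite: Nekovar2009HiddenSymmetries, §1.3.1, §1.3.2 (1.3.2.3)] -/
def quotientTotallyPositiveUnitsEquivKerVerlagerung :
    (maximalRealSubfield K)ˣ ⧸ totallyPositiveUnits (maximalRealSubfield K) ≃*
      (verlagerung (maximalRealSubfield K) K).toMonoidHom.ker :=
  ((QuotientGroup.quotientMulEquivOfEq (ker_archArtinHom (K := maximalRealSubfield K))).symm.trans
    (QuotientGroup.quotientKerEquivRange (archArtinHom (maximalRealSubfield K)))).trans
    (MulEquiv.subgroupCongr (ker_verlagerung_eq_range_archArtinHom K).symm)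

/-- On classes: `(a F_+^*) ↦ [(a)_∞, F]`. [cite: Nekovar2009HiddenSymmetries, §1.3.2 (1.3.2.3)] -/
@[simp] theorem coe_quotientTotallyPositiveUnitsEquivKerVerlagerung_mk (a : (maximalRealSubfield K)ˣ) :
    ((quotientTotallyPositiveUnitsEquivKerVerlagerung K (QuotientGroup.mk a) :
        (verlagerung (maximalRealSubfield K) K).toMonoidHom.ker) : absoluteGaloisGroupAbelianization (maximalRealSubfield K)) =
      archArtinHom (maximalRealSubfield K) a :=
  rfl

/-- **`|Ker(V_{K/F})| = 2^{|X|}`**, `|X| = nrRealPlaces K⁺`. [cite: Nekovar2009HiddenSymmetries, §1.3.2 (1.3.2.3), §1.3.1] -/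
theorem natCard_ker_verlagerung :
    Nat.card (verlagerung (maximalRealSubfield K) K).toMonoidHom.ker = 2 ^ InfinitePlace.nrRealPlaces (maximalRealSubfield K) := by
  rw [← Nat.card_congr (quotientTotallyPositiveUnitsEquivKerVerlagerung K).toEquiv, ← Subgroup.index_eq_card,
    index_totallyPositiveUnits]

/-- **`|Ker(V_{K/F})| = 2^{[K⁺:ℚ]}`** (`K⁺` totally real). [cite: Nekovar2009HiddenSymmetries, §1.3.2 (1.3.2.3)] -/
theorem natCard_ker_verlagerung_eq_two_pow_finrank :
    Nat.card (verlagerung (maximalRealSubfield K) K).toMonoidHom.ker = 2 ^ Module.finrank ℚ (maximalRealSubfield K) := by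
  rw [natCard_ker_verlagerung K, IsTotallyReal.finrank]

end Kernel

/-! ### §2. «`r_F` induces an isomorphism `F^*/F_+^* ⥲ ⟨c_X⟩`» on the tree's `⟨c_X⟩ = realConjSubgroup` -/

section RealConj

variable (K : Type) [Field K] [NumberField K] [IsCMField K] {φ : ℚ →+* ℝ} {c : absoluteGaloisGroup ℚ} (hc : IsComplexConjugation φ c)
  {s : (realImage K →ₐ[ℚ] AlgebraicClosure ℚ) → (AlgebraicClosure ℚ ≃ₐ[ℚ] AlgebraicClosure ℚ)}
  (hs : ∀ x, s x • IsScalarTower.toAlgHom ℚ (realImage K) (AlgebraicClosure ℚ) = x)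

include hc in
/-- **`⟨c_X⟩ = r_F(F^*/F_+^*)`** for rows A3-G81/102's `⟨c_X⟩ = realConjSubgroup hD s ψ_F ≤ Γ_F^ab` (`F = K⁺`): it is the image of
`a ↦ [(a)_∞, F]` on `F^×`. [cite: Nekovar2009HiddenSymmetries, §1.3.1, §1.3.2 (1.3.2.3)] -/
theorem realConjSubgroup_eq_range_archArtinHom :
    realConjSubgroup (isCMStabilizerPair_realImage K hc) hs (cmRealAutProj K) = (archArtinHom (maximalRealSubfield K)).range := by
  rw [← ker_verlagerung_eq_realConjSubgroup K hc hs, ker_verlagerung_eq_range_archArtinHom K]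

include hc in
/-- `r_F(a) = [(a)_∞, F] ∈ ⟨c_X⟩` for every `a ∈ F^×`. [cite: Nekovar2009HiddenSymmetries, §1.3.1] -/
theorem archArtinHom_mem_realConjSubgroup (a : (maximalRealSubfield K)ˣ) :
    archArtinHom (maximalRealSubfield K) a ∈ realConjSubgroup (isCMStabilizerPair_realImage K hc) hs (cmRealAutProj K) := by
  rw [realConjSubgroup_eq_range_archArtinHom K hc hs]
  exact ⟨a, rfl⟩

/-- **«`r_F` induces an isomorphism `F^*/F_+^* ⥲ ⟨c_X⟩`»** with `⟨c_X⟩ = realConjSubgroup` (the numerator of the third term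
`⟨c_X⟩/V_{F/ℚ}(⟨c⟩)` of row A3-G131's exact sequence).  A DEFINITION (with body). [cite: Nekovar2009HiddenSymmetries, §1.3.1, §2.2.1] -/
def quotientTotallyPositiveUnitsEquivRealConjSubgroup :
    (maximalRealSubfield K)ˣ ⧸ totallyPositiveUnits (maximalRealSubfield K) ≃*
      realConjSubgroup (isCMStabilizerPair_realImage K hc) hs (cmRealAutProj K) :=
  ((QuotientGroup.quotientMulEquivOfEq (ker_archArtinHom (K := maximalRealSubfield K))).symm.trans
    (QuotientGroup.quotientKerEquivRange (archArtinHom (maximalRealSubfield K)))).trans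
    (MulEquiv.subgroupCongr (realConjSubgroup_eq_range_archArtinHom K hc hs).symm)

/-- On classes: `(a F_+^*) ↦ [(a)_∞, F]`. [cite: Nekovar2009HiddenSymmetries, §1.3.1] -/
@[simp] theorem coe_quotientTotallyPositiveUnitsEquivRealConjSubgroup_mk (a : (maximalRealSubfield K)ˣ) :
    ((quotientTotallyPositiveUnitsEquivRealConjSubgroup K hc hs (QuotientGroup.mk a) :
        realConjSubgroup (isCMStabilizerPair_realImage K hc) hs (cmRealAutProj K)) :
      absoluteGaloisGroupAbelianization (maximalRealSubfield K)) = archArtinHom (maximalRealSubfield K) a :=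
  rfl

end RealConj

end Literature.NumberTheory.ComplexMultiplication
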